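import Summits.PneNP.PneNP.Theorems.SzkEntropyPeaThreeNotInPSocketPEA
import Summits.PneNP.PneNP.Theorems.SzkEntropyPeaThreeNotInPSocketParity
import Summits.PneNP.PneNP.Theorems.SzkEntropyPeaThreeNotInPSocketParityFP
import HarnessLib

/-!
# Route SzkEntropy, crux `PeaThreeNotInP` (stmt-PneNP-10776), line `SketchIdeator3`, socket rider:
# `PEA d ≤ₚ PEABP` and `PeaThreeNotInP ↔ PEABP ∉ PromiseP`

* `bpEntropy_parityRaw : H(parity programs of P) = H(P(U_n))` (from `stub_parityRaw_fn`: the parity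
  programs sample the bitwise recoding of `P.eval`);
* `PEA_polyTimeReducible_PEABP : PEA d ≤ₚ PEABP` for every `d` (+ `stub_toPEABPRawFP`);
* `PEABP_mem_PromiseP_iff : PEABP ∈ PromiseP ↔ PEA 3 ∈ PromiseP` and
  **`peaThreeNotInP_iff_PEABP_not_mem : PeaThreeNotInP ↔ PEABP ∉ PromiseP`** — the crux is EXACTLY the
  hardness of one-bit entropy approximation for deterministic-branching-program samplers.

Sources: Z. Dvir, D. Gutfreund, G. N. Rothblum, S. Vadhan, ECCC TR10-160 (2010), §3, Thm 4.6;
I. Wegener, *Branching programs and binary decision diagrams* (2000), §1.1.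
-/

namespace Summit.PneNP.PneNP.Cruxes.PeaThreeNotInP.SocketBP

set_option linter.dupNamespace false -- `Summit.PneNP.PneNP.…`: summit = sub-problem name (D-0017)

open _root_.Computability Finset
open Literature.InformationTheory.Entropy
open Literature.Computability.Complexity Literature.Computability.Complexity.RandPoly
open Literature.Computability.Cryptography (toInput fnList freshBDDs encodeBDDsMap encodeBDDs_fst_eq)
open CodeFP (natE pairE rawE listE)
open Summit.PneNP.PneNP.Theses.SzkEntropy (PeaThreeNotInP PeaThreeMemBPP)
open Summit.PneNP.PneNP.Theorems (szkEntropy_peaThreeNotInP_iff szkEntropy_peaThreeMemBPP_iff)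

/-! ### §3 `PEA d ≤ₚ PEABP`: parity programs preserve the output entropy -/

/-- Recoding an `F₂`-string bitwise as Booleans is injective. [folklore] -/
theorem map_decide_eq_one_injective :
    Function.Injective (fun l : List (ZMod 2) => l.map fun v => decide (v = 1)) := by
  intro l l' h
  have hinj : Function.Injective (fun v : ZMod 2 => decide (v = 1)) := by decide
  exact (List.map_injective_iff.2 hinj) h

/-- **The parity programs of a sparse map sample the same distribution up to the bitwise recoding
`F₂ ≃ Bool`**: `bpMap = (decide (· = 1))^* ∘ P.eval`. [Wegener 2000, §1.1] [folklore] -/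
theorem bpMap_parityRaw {n : ℕ} (P : PolyMapF2 n) :
    bpMap n ((natOf P).map parityRaw) = fun x => (P.eval x).map fun v => decide (v = 1) := by
  funext x
  simp only [bpMap, fnList, compileAll, natOf, List.map_map, Function.comp_def, PolyMapF2.eval]
  refine List.map_congr_left fun p _ => ?_
  exact stub_parityRaw_fn p x

/-- **The parity programs have the output entropy of the map**: `H(bpMap) = H(P(U_n))`.
[cite: DvirGutfreundRothblumVadhan2010, §3 p.6] -/
theorem bpEntropy_parityRaw {n : ℕ} (P : PolyMapF2 n) :
    bpEntropy n ((natOf P).map parityRaw) = P.entropy := by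
  unfold bpEntropy PolyMapF2.entropy
  rw [bpMap_parityRaw]
  exact Literature.InformationTheory.Entropy.mapEntropy_comp_of_injOn P.eval
    (fun l : List (ZMod 2) => l.map fun v => decide (v = 1))
    fun a _ b _ h => map_decide_eq_one_injective h

/-- **Sparse polynomial maps are branching-program samplers: `PEA d ≤ₚ PEABP` for every `d`**
(the degree promise is not used). [Wegener 2000, §1.1; DGRV 2010, §3] [cite: DvirGutfreundRothblumVadhan2010, §3 p.6] -/
theorem PEA_polyTimeReducible_PEABP (d : ℕ) : (PEA d).PolyTimeReducible PEABP := by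
  obtain ⟨F, hF, hFr⟩ := stub_toPEABPRawFP
  have hred : ∀ I : PEAInst, F (PEAInst.encoding.encode I) =
      PEABPInst.encoding.encode ((I.1, (natOf I.2.1).map parityRaw, I.2.2) : PEABPInst) := by
    intro I
    rw [encode_eq_instE, hFr, encode_eq_peabpE]
    rfl
  refine ⟨F, hF, fun w hw => ?_, fun w hw => ?_⟩
  · have hw' := hw
    obtain ⟨I, -, rfl⟩ : ∃ I, I ∈ _ ∧ PEAInst.encoding.encode I = w := hw
    rw [hred]
    have hw2 := (encode_mem_PEA_yes_iff d I).1 hw'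
    refine (encode_mem_PEABP_yes_iff _).2 ?_
    change (I.2.2 : ℝ) + 1 ≤ bpEntropy I.1 ((natOf I.2.1).map parityRaw)
    rw [bpEntropy_parityRaw]
    exact hw2.2
  · have hw' := hw
    obtain ⟨I, -, rfl⟩ : ∃ I, I ∈ _ ∧ PEAInst.encoding.encode I = w := hw
    rw [hred]
    have hw2 := (encode_mem_PEA_no_iff d I).1 hw'
    refine (encode_mem_PEABP_no_iff _).2 ?_
    change bpEntropy I.1 ((natOf I.2.1).map parityRaw) ≤ (I.2.2 : ℝ)
    rw [bpEntropy_parityRaw]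
    exact hw2.2

/-! ### §4 The crux is exactly the hardness of `PEABP` -/

/-- **`PEABP ∈ PromiseP ↔ PEA 3 ∈ PromiseP`** (entropy approximation for branching-program samplers
and for sparse cubic maps are Karp-inter-reducible). [cite: DvirGutfreundRothblumVadhan2010, Thm 4.6] -/
theorem PEABP_mem_PromiseP_iff : PEABP ∈ PromiseP ↔ PEA 3 ∈ PromiseP :=
  ⟨fun h => PromiseProblem.mem_PromiseP_of_polyTimeReducible_holds (PEA_polyTimeReducible_PEABP 3) h,
    fun h => PromiseProblem.mem_PromiseP_of_polyTimeReducible_holds PEABP_polyTimeReducible_PEA_three h⟩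

/-- **The crux `PeaThreeNotInP` is EXACTLY the statement that entropy approximation (to within one
bit, Shannon entropy of the output on a uniform input) for maps given by deterministic branching
programs is not in promise-`P`.** [cite: DvirGutfreundRothblumVadhan2010, Thm 4.6] -/
theorem peaThreeNotInP_iff_PEABP_not_mem : PeaThreeNotInP ↔ PEABP ∉ PromiseP := by
  rw [szkEntropy_peaThreeNotInP_iff, PEABP_mem_PromiseP_iff]

/-- The converse transfer: the crux makes `PEABP` hard. [cite: DvirGutfreundRothblumVadhan2010, Thm 4.6] -/
theorem PEABP_not_mem_of_peaThreeNotInP (h : PeaThreeNotInP) : PEABP ∉ PromiseP :=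
  peaThreeNotInP_iff_PEABP_not_mem.1 h


end Summit.PneNP.PneNP.Cruxes.PeaThreeNotInP.SocketBP
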